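import Summits.ABC.IUTFork.DAGC312o
import Summits.ABC.IUTFork.DAGC312q
import Summits.ABC.IUTFork.DAGL4u
import Summits.ABC.IUTFork.DAGL4v
import Summits.ABC.IUTFork.DAGL4w
import Summits.ABC.IUTFork.DAGL4x
import Summits.ABC.IUTFork.DAGRe
import Summits.ABC.IUTFork.DAGXa
import Summits.ABC.IUTFork.DAGXc
import Summits.ABC.IUTFork.DAGXh
import HarnessLib

/-!
# L4 LAYER CERTIFICATE, part B — VERSION v11 — the [AbsTopI] / [AbsTopII] / [AbsAnab] members of the [IUTchIII] Cor 3.12 cone, packaged BY NAME over the kernel DAG index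

abc-iut cell, director-abc 2026-08-26T05:19:55Z (C2) «each layer files `Conditional/Layer<k>OfS.lean` = the layer's nodes discharged modulo S +
facts (a conjunction theorem), so the apex imports six certificates instead of 793 nodes»; C lead abc-iut-plan (plan/C/ABC-OF-S-SPEC.md §3);
shape = the L6 pattern of record (plan/L6/CERT-L6.md §1, conjunct conventions K1–K5, R-def (b); files `Conditional/Layer6OfS*.lean`).
Generator and v0–v3 of record: seat abc-iut-w6-d032 (wave W6, block C; row CERT-L4, TAKE 06:40:28Z); v4–v9 run by seat abc-iut-w6-d071
(gen 3; CERT-L2 writer of record) on the L4 lead's GO 2026-08-26T13:53:03Z (v4) and mover lines 15:24:58Z / 15:50:25Z / 16:08:08Z (v5), 16:27:24Z / 16:46:17Z (v6), 17:04:06Z (v7), 17:24:59Z (v8), 17:53:09Z (v9); v10 (p470906/p471142/p471357) and this v11 run by seat abc-iut-c312-2 (gen 6; the kernel-DAG index lineage) on the L4 lead's «GO c312-2 CERT-V10» (m88 21:42:46Z) and «SWAP ALL PRIMED = YES» + «GO c312-2 CERT-V11» (23:0xZ), with abc-iut-w6-d071 g3's cert10 recipe; tools read-only except `build_map.py` (primed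 CORRECTED SIBLING preferred for the re-keyed nodes named in env SWAP_PRIMED; typographic primes of DAG.tsv normalised to ASCII; witness regex accepts primes) and `gen_companion_v5.py` (primed names). v11 (abc-iut-c312-2 gen 6 on the L4 lead's «SWAP ALL PRIMED = YES» + «GO c312-2 CERT-V11» 23:0xZ): (i) the three further corrected index siblings swapped in — N_AbsTopI_Prop4_10_i' and N_AbsTopI_Prop4_10_iii' (DAGRe) in part B, N_AbsTopIII_Cor5_2_iii' (DAGRd) in part A: CLAIM nodes (conjunctions of landed theorems about those items) replacing the UNPRIMED mis-resolved DATA aliases ⇒ 3 nodes d_data → r; (ii) N_AbsTopIII_Cor3_6_v (Discharged since v10; index node (a)(b)-vocabulary only, under-pointed) swapped to the corrected sibling N_AbsTopIII_Cor3_6_v' := StatementOf TFModel.cor_3_6_v_all_model ∧ cor_3_6_joint_model with _holds (index re-key p474126); AbsTopIII:Cor3.7(i)–(v) (overlay rows 68–72, COUNT 95) are NOT members of the Cor 3.12 cone (plan/COR312-CONE.tsv) ⇒ no certificate move; AbsTopIII:Cor2.9 FORCED Residual per RULING #8j although DAG.tsv 22:23:37Z now shows the overlay status for it; R-def (b) in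 force MAP of record:
HOME/staging/c312/c312-2/gen6/cert11/CERT-L4-MAP-v11.tsv (+ CERT-L4-OVERRIDES-v11.tsv; recipe copy of HOME/staging/w6/w6-d071/g3/cert10/)
(mechanical: plan/COR312-CONE.tsv @06:15:02Z L4 rows × plan/DAG.tsv kernel_id/status × the index `Summits/ABC/IUTFork/DAGL4*.lean` of
abc-iut-c312-2, parts DAGC312o, DAGC312q, DAGL4u, DAGL4v, DAGL4w, DAGL4x, DAGRe, DAGXa, DAGXc, DAGXh). STATUS SOURCE = plan/DAG.tsv status (= COR312-CONE status_class) OVERLAID by the L4 lead's countersigned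
node-level discharges plan/L4/DISCHARGE-OVERLAY-L4.tsv (NODES wins; rows tagged OVERRIDE below); further moves land as the next versioned files (append-only).

THIS FILE PROVES NOTHING NEW AND ASSERTS NOTHING: every conjunct is an index Prop `N_<id>` (or index sub-row Prop `N_<id>_L<nn>` / `_r<n>`)
BY NAME, universe-instantiated with shared level names `u₁ u₂ u₃` (positional: a conjunct's i-th universe parameter is `uᵢ`), and every witness is
the index's own `_holds` / `_part` term BY NAME — no tactic proof of content, no restatement, no new `def … : Prop` fact, no `instance`, no schema
∀-closed.  It PACKAGES the [AbsTopI] / [AbsTopII] / [AbsAnab] slice of the L4 cone into ONE discharged conjunction and ONE residual conjunction for the apex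
`Conditional/AbcOfS` (via the top file `Conditional/Layer4OfS.lean`, binder `Layer4Residual11`; this v11 file SUPERSEDES the conjunctions of the v7 part B (`Layer4OfSb7`, the part B of record for v7–v10: parts b8–b10 were never filed because B's conjunct set did not move), which stays in the tree as the record — gate rule append-only: never mutate a def body).

COUNT LINE (split form «nodes = d + r + d_data + not-indexed»): **[AbsTopI] / [AbsTopII] / [AbsAnab] slice 38 = d 17 (DAG-discharged claim nodes; conjuncts of
`Layer4DischargedB11`, + 14 witnessed index sub-rows of those nodes) + r 11 (Residual: DAG-landed claim nodes = this slice's entries on the C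
scoreboard; conjuncts of `Layer4ResidualB11`) + d_data 10 (K4: index data aliases `abbrev N_<id> := @decl` of definitions / structures /
FACT-style named Props — omitted from the conjunctions, NAME-CHECKED below as `example := @N_…`; DAG-discharged 2 · DAG-landed 8) + not-indexed 0
(K5; listed).  17 + 11 + 10 + 0 = 38.**
KERNEL NOTE (honest, as in the L6 certificate): every index claim Prop is a `StatementOf` conjunction of LANDED theorems, so each RESIDUAL
conjunct is ALSO kernel-inhabited by the index's `_part`/`_holds`; «discharged vs residual» is the DAG/NODES row STATUS (the judgement that the
typed theorems cover the printed item), not kernel provability — r is a documented bookkeeping count; no residual conjunct is an open kernel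
obligation.  S consumed at L4: NO (S = `PilotKummerIndRelated` enters at the Cor 3.12 node, c312's layer).  FACT-LIST inputs: the named
facts bound INSIDE the conjoined statements (instance forms, by F-id) are those of the L4 lead's feeder plan/L4/CONE-L4.tsv /
plan/L4/FACT-LIST-L4-witnesses.tsv; v0 does not re-census them (inputs named, not endorsed).
HONEST FRAMING: typed ≠ proved; indexed ≠ endorsed; witnessed ≠ lead-discharged; nothing here asserts that abc is proved or refuted or
takes a side on [IUTchIII] Cor. 3.12. [claim: Mochizuki2012, status: disputed] (node texts). Version: v11 2026-08-26.

d_data — K4 index data aliases (tag [data]); text = node · index alias · index part · DAG status: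
* AbsAnab:Lem2.5(i) [Lemma] — `N_AbsAnab_Lem2_5_i` (DAGXh.lean); DAG landed(p405318)
* AbsAnab:Thm1.1.1 [Theorem] — `N_AbsAnab_Thm1_1_1` (DAGL4u.lean); DAG landed(p403978)
* AbsTopII:Cor3.3(i) [Corollary] — `N_AbsTopII_Cor3_3_i` (DAGL4v.lean); DAG landed(p405052)
* AbsTopI:Lem4.5(i) [Lemma] — `N_AbsTopI_Lem4_5_i` (DAGL4u.lean); DAG landed(p406295)
* AbsTopI:Lem4.5(iii) [Lemma] — `N_AbsTopI_Lem4_5_iii` (DAGL4v.lean); DAG landed(p405907)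
* AbsTopI:Lem4.5(iv) [Lemma] — `N_AbsTopI_Lem4_5_iv` (DAGL4v.lean); DAG landed(p406295)
* AbsTopI:Lem4.5(vi) [Lemma] — `N_AbsTopI_Lem4_5_vi` (DAGL4v.lean); DAG landed(p406295)
* AbsTopI:Prop2.3(i) [Proposition] — `N_AbsTopI_Prop2_3_i` (DAGL4u.lean); DAG landed(p405607) → OVERRIDE discharged (L4-lead overlay DISCHARGED ✓ (count 66, 2026-08-26T13:01Z) «at the Def 2.1 (i) GFG construction, every hyperbol [p405607 p440186 p440871])
* AbsTopI:Prop4.10(vi) [Proposition] — `N_AbsTopI_Prop4_10_vi` (DAGL4v.lean); DAG landed(p404715)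
* AbsTopI:Thm2.6(iii) [Theorem] — `N_AbsTopI_Thm2_6_iii` (DAGL4u.lean); DAG discharged(p448752) → OVERRIDE discharged (L4-lead overlay DISCHARGED ✓ AT READING «(∗)_Σ + splitting + Prop 2.2 + Def 2.1 (i) almost pro-Σ + MLF base by  [p448603 p448752 p447075])
-/

namespace Summit.ABC.IUTFork.Conditional

open Summit.ABC.IUTFork.DAG

universe u₁ u₂ u₃

/-- **L4 discharged, part B** ([AbsTopI] / [AbsTopII] / [AbsAnab]): the DAG-discharged claim nodes of the slice (17 nodes, 31 conjuncts incl. witnessed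
index sub-rows), each the index Prop BY NAME. [claim: Mochizuki2012, status: disputed] -/
def Layer4DischargedB11 : Prop :=
  -- AbsAnab:Lem1.1.4 [Lemma] · DAG landed(p404357) → OVERRIDE discharged (L4-lead overlay discharged(p421437) COUNTERSIGNED (T1)) · DAGL4u.lean · `_part`
  N_AbsAnab_Lem1_1_4
  -- AbsAnab:Lem1.3.1 [Lemma] · DAG landed(p404357) → OVERRIDE discharged (L4-lead overlay DISCHARGED ✓ «PROVED at the Def 2.1 (i) GFG construction, every hyperbolic (g,r), MLF and NF ba [p455731]) · DAGL4u.lean · `_part`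
  ∧ N_AbsAnab_Lem1_3_1.{u₁}
  -- AbsAnab:Lem1.3.8 [Lemma] · DAG landed(p404357) → OVERRIDE discharged (L4-lead overlay DISCHARGED ✓ «PROVED at the construction for NF (any Σ) and MLF Σ ⊊ Primes outright; MLF Σ = Pr [p455731]) · DAGL4u.lean · `_part`
  ∧ N_AbsAnab_Lem1_3_8
  -- AbsAnab:Prop1.2.1(i) [Proposition] · DAG landed(p403978) → OVERRIDE discharged (L4-lead overlay discharged(p412652) COUNTERSIGNED (T1)) · DAGL4v.lean · `_part`
  ∧ N_AbsAnab_Prop1_2_1_i.{u₁, u₂}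
  -- AbsAnab:Prop1.2.1(ii) [Proposition] · DAG landed(p403978) → OVERRIDE discharged (L4-lead overlay discharged(p412652) COUNTERSIGNED (T1)) · DAGL4v.lean · `_part`
  ∧ N_AbsAnab_Prop1_2_1_ii.{u₁, u₂}
  -- AbsAnab:Prop1.2.1(iii) [Proposition] · DAG landed(p404656) → OVERRIDE discharged (L4-lead overlay DISCHARGED ✓ (count 63, 2026-08-26T12:23Z) [p404656 p408954 p412652]) · DAGL4v.lean · `_part`
  ∧ N_AbsAnab_Prop1_2_1_iii.{u₁, u₂}
  -- AbsAnab:Prop1.2.1(iv) [Proposition] · DAG landed(p403978) → OVERRIDE discharged (L4-lead overlay DISCHARGED ✓ (count 64, 2026-08-26T12:23Z) [p403978 p412652]) · DAGL4v.lean · `_part`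
  ∧ N_AbsAnab_Prop1_2_1_iv.{u₁, u₂}
  -- AbsAnab:Prop1.2.1(v) [Proposition] · DAG landed(p403978) → OVERRIDE discharged (L4-lead overlay discharged(p412652) COUNTERSIGNED (T1)) · DAGL4v.lean · `_part`
  ∧ N_AbsAnab_Prop1_2_1_v
  -- AbsAnab:Prop1.2.1(vi) [Proposition] · DAG landed(p403978) → OVERRIDE discharged (L4-lead overlay discharged(p412652) COUNTERSIGNED (T1)) · DAGL4v.lean · `_part`
  ∧ N_AbsAnab_Prop1_2_1_vi.{u₁}
  -- AbsAnab:Prop1.2.1(vii) [Proposition] · DAG discharged(p417023) → OVERRIDE discharged (L4-lead overlay discharged(p417023) COUNTERSIGNED (T1)) · DAGC312o.lean · `_holds`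
  ∧ N_AbsAnab_Prop1_2_1_vii
  --   sub-row of AbsAnab:Prop1.2.1(vii) · DAGL4w.lean
  ∧ N_AbsAnab_Prop1_2_1_vii_L00.{u₁}
  --   sub-row of AbsAnab:Prop1.2.1(vii) · DAGL4w.lean
  ∧ N_AbsAnab_Prop1_2_1_vii_L01a.{u₁}
  --   sub-row of AbsAnab:Prop1.2.1(vii) · DAGL4x.lean
  ∧ N_AbsAnab_Prop1_2_1_vii_L01b.{u₁}
  --   sub-row of AbsAnab:Prop1.2.1(vii) · DAGL4x.lean
  ∧ N_AbsAnab_Prop1_2_1_vii_L02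
  --   sub-row of AbsAnab:Prop1.2.1(vii) · DAGL4w.lean
  ∧ N_AbsAnab_Prop1_2_1_vii_L03.{u₁}
  --   sub-row of AbsAnab:Prop1.2.1(vii) · DAGL4x.lean
  ∧ N_AbsAnab_Prop1_2_1_vii_L04.{u₁}
  --   sub-row of AbsAnab:Prop1.2.1(vii) · DAGXa.lean
  ∧ N_AbsAnab_Prop1_2_1_vii_L05.{u₁}
  --   sub-row of AbsAnab:Prop1.2.1(vii) · DAGL4x.lean
  ∧ N_AbsAnab_Prop1_2_1_vii_L06.{u₁}
  --   sub-row of AbsAnab:Prop1.2.1(vii) · DAGL4w.lean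
  ∧ N_AbsAnab_Prop1_2_1_vii_L06a.{u₁}
  --   sub-row of AbsAnab:Prop1.2.1(vii) · DAGL4w.lean
  ∧ N_AbsAnab_Prop1_2_1_vii_L07
  --   sub-row of AbsAnab:Prop1.2.1(vii) · DAGL4w.lean
  ∧ N_AbsAnab_Prop1_2_1_vii_L08.{u₁}
  --   sub-row of AbsAnab:Prop1.2.1(vii) · DAGXa.lean
  ∧ N_AbsAnab_Prop1_2_1_vii_L09
  --   sub-row of AbsAnab:Prop1.2.1(vii) · DAGL4w.lean
  ∧ N_AbsAnab_Prop1_2_1_vii_L09a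
  --   sub-row of AbsAnab:Prop1.2.1(vii) · DAGXa.lean
  ∧ N_AbsAnab_Prop1_2_1_vii_L10.{u₁}
  -- AbsTopI:Ex4.8(i) [Example] · DAG discharged(p407449) · DAGL4v.lean · `_holds`
  ∧ N_AbsTopI_Ex4_8_i.{u₁}
  -- AbsTopI:Ex4.8(ii) [Example] · DAG discharged(p407449) · DAGL4v.lean · `_holds`
  ∧ N_AbsTopI_Ex4_8_ii.{u₁}
  -- AbsTopI:Lem4.5(ii) [Lemma] · DAG landed(p405607) → OVERRIDE discharged (L4-lead overlay discharged(p406539) COUNTERSIGNED (T1)) · DAGL4v.lean · `_part`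
  ∧ N_AbsTopI_Lem4_5_ii.{u₁, u₂, u₃}
  -- AbsTopI:Prop2.3(ii) [Proposition] · DAG landed(p405607) → OVERRIDE discharged (L4-lead overlay DISCHARGED ✓ AT THE READING OF Prop2.3(i) «PROVED at the Def 2.1 (i) GFG construction for every [p455625 p440871 p443488]) · DAGL4u.lean · `_part`
  ∧ N_AbsTopI_Prop2_3_ii.{u₁}
  -- AbsTopI:Thm2.6(ii) [Theorem] · DAG landed(p405607) → OVERRIDE discharged (L4-lead overlay discharged(p408864) COUNTERSIGNED (T1)) · DAGL4u.lean · `_part`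
  ∧ N_AbsTopI_Thm2_6_ii
  -- AbsTopI:Thm2.6(iv) [Theorem] · DAG landed(p405607) → OVERRIDE discharged (L4-lead overlay DISCHARGED ✓ AT READING «Prop 2.2 + Def 2.1 almost pro-Σ by name» (count 67, 2026-08-26T13:07Z) [p405607 p419653 p444875]) · DAGL4u.lean · `_part`
  ∧ N_AbsTopI_Thm2_6_iv
  -- AbsTopI:Thm2.6(v) [Theorem] · DAG landed(p405607) → OVERRIDE discharged (L4-lead overlay discharged(p414262) COUNTERSIGNED (T1)) · DAGL4u.lean · `_part`
  ∧ N_AbsTopI_Thm2_6_v.{u₁}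

/-- `Layer4DischargedB11` holds: the index witnesses BY NAME (terms only). [claim: Mochizuki2012, status: disputed] -/
theorem layer4DischargedB11_holds : Layer4DischargedB11.{u₁, u₂, u₃} :=
  ⟨N_AbsAnab_Lem1_1_4_part, N_AbsAnab_Lem1_3_1_part, N_AbsAnab_Lem1_3_8_part, N_AbsAnab_Prop1_2_1_i_part,
    N_AbsAnab_Prop1_2_1_ii_part, N_AbsAnab_Prop1_2_1_iii_part, N_AbsAnab_Prop1_2_1_iv_part,
    N_AbsAnab_Prop1_2_1_v_part, N_AbsAnab_Prop1_2_1_vi_part, N_AbsAnab_Prop1_2_1_vii_holds,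
    N_AbsAnab_Prop1_2_1_vii_L00_holds, N_AbsAnab_Prop1_2_1_vii_L01a_holds, N_AbsAnab_Prop1_2_1_vii_L01b_holds,
    N_AbsAnab_Prop1_2_1_vii_L02_holds, N_AbsAnab_Prop1_2_1_vii_L03_holds, N_AbsAnab_Prop1_2_1_vii_L04_holds,
    N_AbsAnab_Prop1_2_1_vii_L05_holds, N_AbsAnab_Prop1_2_1_vii_L06_holds, N_AbsAnab_Prop1_2_1_vii_L06a_holds,
    N_AbsAnab_Prop1_2_1_vii_L07_holds, N_AbsAnab_Prop1_2_1_vii_L08_holds, N_AbsAnab_Prop1_2_1_vii_L09_holds,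
    N_AbsAnab_Prop1_2_1_vii_L09a_holds, N_AbsAnab_Prop1_2_1_vii_L10_holds, N_AbsTopI_Ex4_8_i_holds,
    N_AbsTopI_Ex4_8_ii_holds, N_AbsTopI_Lem4_5_ii_part, N_AbsTopI_Prop2_3_ii_part, N_AbsTopI_Thm2_6_ii_part,
    N_AbsTopI_Thm2_6_iv_part, N_AbsTopI_Thm2_6_v_part⟩

/-- **L4 residual, part B** ([AbsTopI] / [AbsTopII] / [AbsAnab]): the DAG-landed (not discharged) claim nodes of the slice (11 conjuncts) — this
slice's entries on the C scoreboard; each the index Prop BY NAME (no theorem asserted here). [claim: Mochizuki2012, status: disputed] -/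
def Layer4ResidualB11 : Prop :=
  -- AbsAnab:Lem2.5(ii) [Lemma] · DAG landed(p405318) · DAGXc.lean · index witness `_part` (K: kernel-inhabited; residual = not DAG-discharged)
  N_AbsAnab_Lem2_5_ii.{u₁}
  -- AbsTopII:Cor3.3(ii) [Corollary] · DAG landed(p404980) · DAGL4v.lean · index witness `_part` (K: kernel-inhabited; residual = not DAG-discharged)
  ∧ N_AbsTopII_Cor3_3_ii.{u₁}
  -- AbsTopII:Cor3.3(iii) [Corollary] · DAG landed(p405052) · DAGL4v.lean · index witness `_part` (K: kernel-inhabited; residual = not DAG-discharged)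
  ∧ N_AbsTopII_Cor3_3_iii.{u₁}
  -- AbsTopI:Lem4.5(v) [Lemma] · DAG landed(p406295) · DAGL4v.lean · index witness `_part` (K: kernel-inhabited; residual = not DAG-discharged)
  ∧ N_AbsTopI_Lem4_5_v.{u₁}
  -- AbsTopI:Prop4.10(i) [Proposition] · DAG landed(p404715) · DAGRe.lean · index witness `_part` (K: kernel-inhabited; residual = not DAG-discharged)
  ∧ N_AbsTopI_Prop4_10_i'
  -- AbsTopI:Prop4.10(ii) [Proposition] · DAG landed(p404715) · DAGXc.lean · index witness `_part` (K: kernel-inhabited; residual = not DAG-discharged)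
  ∧ N_AbsTopI_Prop4_10_ii
  -- AbsTopI:Prop4.10(iii) [Proposition] · DAG landed(p414417) · DAGRe.lean · index witness `_part` (K: kernel-inhabited; residual = not DAG-discharged)
  ∧ N_AbsTopI_Prop4_10_iii'.{u₁, u₂, u₃}
  -- AbsTopI:Prop4.10(iv) [Proposition] · DAG landed(p404715) · DAGL4v.lean · index witness `_part` (K: kernel-inhabited; residual = not DAG-discharged)
  ∧ N_AbsTopI_Prop4_10_iv.{u₁}
  -- AbsTopI:Prop4.10(v) [Proposition] · DAG landed(p414417) · DAGL4v.lean · index witness `_part` (K: kernel-inhabited; residual = not DAG-discharged)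
  ∧ N_AbsTopI_Prop4_10_v.{u₁, u₂}
  -- AbsTopI:Thm2.6(i) [Theorem] · DAG landed(p405607) · DAGL4u.lean · index witness `_part` (K: kernel-inhabited; residual = not DAG-discharged)
  ∧ N_AbsTopI_Thm2_6_i.{u₁}
  -- AbsTopI:Thm2.6(vi) [Theorem] · DAG landed(p405607) · DAGL4u.lean · index witness `_part` (K: kernel-inhabited; residual = not DAG-discharged)
  ∧ N_AbsTopI_Thm2_6_vi.{u₁}

/-- The [AbsTopI] / [AbsTopII] / [AbsAnab] slice of the L4 cone: discharged ∧ residual. [claim: Mochizuki2012, status: disputed] -/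
def Layer4ConeB11 : Prop :=
  Layer4DischargedB11.{u₁, u₂, u₃} ∧ Layer4ResidualB11.{u₁, u₂, u₃}

/-- The slice follows from its residual alone (the discharged half is witnessed BY NAME). [claim: Mochizuki2012, status: disputed] -/
theorem layer4ConeB11_of (h : Layer4ResidualB11.{u₁, u₂, u₃}) :
    Layer4ConeB11.{u₁, u₂, u₃} :=
  ⟨layer4DischargedB11_holds.{u₁, u₂, u₃}, h⟩

/-! ### d_data rows and residual-node sub-rows — NAME-CHECKED ONLY (the build breaks if an index name drifts; no Prop is asserted) -/
noncomputable example := @N_AbsAnab_Lem2_5_i.{u₁} -- AbsAnab:Lem2.5(i) [Lemma] · DAG landed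
noncomputable example := @N_AbsAnab_Thm1_1_1 -- AbsAnab:Thm1.1.1 [Theorem] · DAG landed
noncomputable example := @N_AbsTopII_Cor3_3_i.{u₁} -- AbsTopII:Cor3.3(i) [Corollary] · DAG landed
noncomputable example := @N_AbsTopI_Lem4_5_i.{u₁} -- AbsTopI:Lem4.5(i) [Lemma] · DAG landed
noncomputable example := @N_AbsTopI_Lem4_5_iii.{u₁} -- AbsTopI:Lem4.5(iii) [Lemma] · DAG landed
noncomputable example := @N_AbsTopI_Lem4_5_iv.{u₁} -- AbsTopI:Lem4.5(iv) [Lemma] · DAG landed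
noncomputable example := @N_AbsTopI_Lem4_5_vi.{u₁} -- AbsTopI:Lem4.5(vi) [Lemma] · DAG landed
noncomputable example := @N_AbsTopI_Prop2_3_i.{u₁} -- AbsTopI:Prop2.3(i) [Proposition] · DAG discharged
noncomputable example := @N_AbsTopI_Prop4_10_vi.{u₁} -- AbsTopI:Prop4.10(vi) [Proposition] · DAG landed
noncomputable example := @N_AbsTopI_Thm2_6_iii.{u₁} -- AbsTopI:Thm2.6(iii) [Theorem] · DAG discharged

end Summit.ABC.IUTFork.Conditional
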